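import Literature.NumberTheory.IwasawaTheory.ClassicalMuInvariant
import HarnessLib

/-!
# Growth-form bookkeeping for `μ = 0`: linear bounds on `e_n = ord_p h(K_n)` and descent of `μ = 0`
# from subfield towers (norm-relation inequality; Kuroda's `V₄` relation)

Topic `NumberTheory/IwasawaTheory` (namespace = path).  THEOREM-ONLY file (no definition, no named fact, no
`sorry`), written by the literature seat `bsd-potss-conjA-anchor` g10 (cell `bsd-potss`; supports
stmt-BirchSwinnertonDyer-19386 / 19413; closes nothing).  It turns the per-layer class-number relations the
tree already proves —

* the NORM-RELATION INEQUALITY `v_p h(L) ≤ ∑ᵢ v_p h(L^{Hᵢ})` for a Galois extension `L/F` whose group carries a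
  norm relation `d = ∑ᵢ aᵢ N_{Hᵢ} bᵢ` with `p ∤ d` ([BiasseEtAl2022] Prop. 3.7; tree
  `Literature.NumberTheory.NumberFields.NormRelation.padicValNat_card_classGroup_le_sum_of_normRelation`), and
* KURODA'S RELATION `e(L) + 2e(k) = e(X) + 2e(K)` for the odd parts in a `D₄`/`SD₁₆` layer
  ([Lemmermeyer1994] §1; tree `Literature.NumberTheory.NumberFields.KurodaOddPart.card_torsion_classGroup_dihedral`)

— applied at every layer `n` of the cyclotomic `ℤ_p`-towers, into statements about the growth-form predicate
`ClassicalMuVanishes` of `Literature/NumberTheory/IwasawaTheory/ClassicalMuInvariant.lean`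
(`e_n = λ n + ν` for `n ≫ 0`, i.e. Iwasawa's `μ = 0`, [RaySujatha2021] §1 (1.1), [Lang1990] Ch. 5 §1 Thm. 1.2):

* `classicalMuVanishes_of_eventually_intLinear` — growth form with an INTEGER slope already gives `μ = 0`
  (the slope of a non-negative eventually-linear sequence is `≥ 0`);
* `classicalMuVanishes_of_classNumberPExp_le_linear` — under Iwasawa's growth theorem (tree fact
  `iwasawa1959_classNumberPExp_growth`: `e_n = μ pⁿ + λ n + ν`), a LINEAR UPPER BOUND `e_n ≤ a n + b` for
  `n ≫ 0` forces `μ = 0` (`pⁿ` outgrows `a n + b`);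
* `classicalMuVanishes_of_le_sum` — DESCENT, inequality form: if `e_n(κ) ≤ ∑ᵢ cᵢ e_n(κᵢ) + b` for `n ≫ 0`
  (the per-layer norm-relation inequality, with the sub-towers `κᵢ` of the fields `L^{Hᵢ}` identified with the
  fixed fields of the layers) and every `κᵢ` has `μ = 0`, then `κ` has `μ = 0` (under the growth fact);
* `classicalMuVanishes_of_kuroda` — DESCENT, Kuroda form, FACT-FREE: if
  `e_n(κ_L) + 2 e_n(κ_k) = e_n(κ_X) + 2 e_n(κ_K)` for `n ≫ 0` and `κ_X, κ_K, κ_k` have `μ = 0`, then `κ_L` has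
  `μ = 0` (indeed `μ(L) = μ(X) + 2μ(K) − 2μ(k)` at the level of the exponents).

The identification of the sub-towers with the fixed fields of the layers (`(L^H)_n = (L_n)^H`, routine Galois
theory since `L ∩ ℚ_∞ = ℚ` when `p ∤ [L:ℚ]`) is NOT formalised here: it is the displayed hypothesis `hle` /
`hrel` of the descent theorems, exactly as the single-layer relations are displayed inputs of the cell's census
(planner tiers R215/R216 of `pub/bsd-potss/TARGET.md`).

References: [BiasseEtAl2022] Prop. 3.7; [Lemmermeyer1994] §1; [Lang1990] Ch. 5 §1 Thm. 1.2 (iii), Ch. 5 §4;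
[RaySujatha2021] §1 eq. (1.1); [Fukuda1994] Thm. 1; [FerreroWashington1979].
-/

noncomputable section

namespace Literature.NumberTheory.IwasawaTheory

open Literature.NumberTheory.EllipticCurves

variable {K : Type} [Field K] [NumberField K] {p : ℕ} [Fact p.Prime]

/-! ### §1 Growth form with integer slope; linear upper bounds -/

omit [NumberField K] in
/-- **Growth form with an integer slope is `μ = 0`.**  If `e_n = l·n + ν` for all `n ≥ n₀` with `l, ν ∈ ℤ`,
then `l ≥ 0` (the `e_n` are `≥ 0`) and `ClassicalMuVanishes κ` holds — the predicate asks for `l ∈ ℕ`; this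
reading aid lets relations with integer coefficients (Kuroda, norm relations) conclude directly.
[cite: RaySujatha2021, §1 eq. (1.1)] [cite: Lang1990, Ch. 5 §1 Thm. 1.2 (iii) (pp. 124–129)] -/
theorem classicalMuVanishes_of_eventually_intLinear (κ : ZpExtension K p) {l ν : ℤ} {n₀ : ℕ}
    (h : ∀ n, n₀ ≤ n → (classNumberPExp κ n : ℤ) = l * n + ν) : ClassicalMuVanishes κ := by
  have hl : 0 ≤ l := by
    by_contra hneg
    have hneg' : l ≤ -1 := by omega
    -- at `n = n₀ + |ν| + 1` the value `l n + ν` would be negative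
    set n := n₀ + ν.natAbs + 1 with hn
    have h1 := h n (by omega)
    have h2 : (0 : ℤ) ≤ classNumberPExp κ n := Int.natCast_nonneg _
    have h3 : l * n ≤ -(n : ℤ) := by nlinarith
    have h4 : ν < (n : ℤ) := by
      have h5 : ν ≤ (ν.natAbs : ℤ) := Int.le_natAbs
      have h6 : (n : ℤ) = n₀ + ν.natAbs + 1 := by simp only [hn, Nat.cast_add, Nat.cast_one]
      omega
    omega
  refine ⟨l.toNat, ν, n₀, fun n hn => ?_⟩
  rw [Int.toNat_of_nonneg hl]
  exact h n hn

/-- `2ⁿ` outgrows every linear function: for all `a B N` there is `n ≥ N` with `a·n + B < 2ⁿ`. [folklore] -/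
private theorem exists_linear_lt_two_pow (a B N : ℕ) : ∃ n, N ≤ n ∧ a * n + B < 2 ^ n := by
  set u := 2 * a + B + N + 1 with hu
  refine ⟨2 * u, by omega, ?_⟩
  have h1 : u + 1 ≤ 2 ^ u := u.lt_two_pow_self
  have h2 : 2 ^ (2 * u) = 2 ^ u * 2 ^ u := by rw [two_mul, pow_add]
  have h3 : (u + 1) * (u + 1) ≤ 2 ^ u * 2 ^ u := Nat.mul_le_mul h1 h1
  have h4 : a * (2 * u) + B < (u + 1) * (u + 1) := by nlinarith
  omega

/-- **A linear upper bound on `e_n` forces `μ = 0`** (under Iwasawa's growth theorem, tree fact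
`iwasawa1959_classNumberPExp_growth`: `e_n = μ pⁿ + λ n + ν` for `n ≫ 0`): if `e_n ≤ a·n + b` for all
`n ≥ n₀` then `μ = 0`, i.e. `ClassicalMuVanishes κ` — since `μ ≥ 1` would give `pⁿ ≤ e_n − λn − ν ≤ a n + b + |ν|`
for all large `n`, impossible.  This is the form in which class-number INEQUALITIES (norm relations,
[BiasseEtAl2022] Prop. 3.7) feed the `μ = 0` predicate. [cite: Lang1990, Ch. 5 §1 Thm. 1.2 (iii) (pp. 124–129)]
[cite: RaySujatha2021, §1 eq. (1.1)] -/
theorem classicalMuVanishes_of_classNumberPExp_le_linear (hI : iwasawa1959_classNumberPExp_growth)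
    (κ : ZpExtension K p) {a b n₀ : ℕ} (hle : ∀ n, n₀ ≤ n → classNumberPExp κ n ≤ a * n + b) :
    ClassicalMuVanishes κ := by
  obtain ⟨μ, l, ν, n₁, hμ⟩ := hI K p κ
  rcases Nat.eq_zero_or_pos μ with h0 | hpos
  · subst h0
    exact ⟨l, ν, n₁, fun n hn => by rw [hμ n hn]; push_cast; ring⟩
  · exfalso
    have hp2 : (2 : ℤ) ≤ p := by exact_mod_cast (Fact.out : p.Prime).two_le
    obtain ⟨n, hn, hlt⟩ := exists_linear_lt_two_pow a (b + ν.natAbs) (max n₀ n₁)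
    have hn0 : n₀ ≤ n := le_trans (le_max_left _ _) hn
    have hn1 : n₁ ≤ n := le_trans (le_max_right _ _) hn
    have e1 := hμ n hn1
    have e2 : (classNumberPExp κ n : ℤ) ≤ a * n + b := by exact_mod_cast hle n hn0
    have e3 : (2 : ℤ) ^ n ≤ (p : ℤ) ^ n := pow_le_pow_left₀ (by norm_num) hp2 n
    have e4 : (a : ℤ) * n + (b + ν.natAbs) < 2 ^ n := by exact_mod_cast hlt
    have e5 : (p : ℤ) ^ n ≤ μ * (p : ℤ) ^ n := by
      have : (1 : ℤ) ≤ μ := by exact_mod_cast hpos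
      nlinarith [pow_pos (show (0 : ℤ) < p by linarith) n]
    have e6 : (0 : ℤ) ≤ l * n := by positivity
    have e7 : -ν ≤ (ν.natAbs : ℤ) := by
      have h8 : (-ν).natAbs = ν.natAbs := Int.natAbs_neg ν
      have h9 : -ν ≤ ((-ν).natAbs : ℤ) := Int.le_natAbs
      rw [h8] at h9; exact h9
    omega

/-! ### §2 Descent of `μ = 0` from subfield towers -/

/-- **μ-descent, inequality form.**  Let `κ` be a `ℤ_p`-extension of `K` and `κᵢ` (`i ∈ ι`, finite)
`ℤ_p`-extensions of number fields `Kᵢ`, with `e_n(κ) ≤ ∑ᵢ cᵢ·e_n(κᵢ) + b` for all `n ≥ n₀` — e.g. `K/F` Galois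
with group `G` admitting a norm relation `d = ∑ᵢ aᵢ N_{Hᵢ} bᵢ` with `p ∤ d` ([BiasseEtAl2022] Prop. 3.7, tree
`NormRelation.padicValNat_card_classGroup_le_sum_of_normRelation` at every layer `K_n/F_n`, whose group is `G`
again and whose fixed fields `(K_n)^{Hᵢ}` are the layers of the cyclotomic towers `κᵢ` of `Kᵢ = K^{Hᵢ}` when
`p ∤ [K:F]`).  If every `κᵢ` has `μ = 0` then, under Iwasawa's growth theorem, so does `κ`.
[cite: BiasseEtAl2022, Prop. 3.7] [cite: Lang1990, Ch. 5 §1 Thm. 1.2 (iii) (pp. 124–129)] -/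
theorem classicalMuVanishes_of_le_sum (hI : iwasawa1959_classNumberPExp_growth) (κ : ZpExtension K p)
    {ι : Type} [Fintype ι] {F : ι → Type} [∀ i, Field (F i)] [∀ i, NumberField (F i)]
    (κs : ∀ i, ZpExtension (F i) p) (c : ι → ℕ) {b n₀ : ℕ}
    (hle : ∀ n, n₀ ≤ n → classNumberPExp κ n ≤ (∑ i, c i * classNumberPExp (κs i) n) + b)
    (hμ : ∀ i, ClassicalMuVanishes (κs i)) : ClassicalMuVanishes κ := by
  classical
  choose l ν m hm using hμ
  -- uniform threshold and a linear bound for each sub-tower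
  set N := n₀ + ∑ i, m i with hN
  have hmi : ∀ i, m i ≤ N := fun i =>
    (Finset.single_le_sum (fun j _ => Nat.zero_le (m j)) (Finset.mem_univ i)).trans (Nat.le_add_left _ _)
  have hbd : ∀ i n, N ≤ n → classNumberPExp (κs i) n ≤ l i * n + (ν i).natAbs := by
    intro i n hn
    have h1 := hm i n ((hmi i).trans hn)
    have h2 : (classNumberPExp (κs i) n : ℤ) ≤ l i * n + ((ν i).natAbs : ℤ) := by
      rw [h1]; have := @Int.le_natAbs (ν i); linarith
    exact_mod_cast h2
  refine classicalMuVanishes_of_classNumberPExp_le_linear hI κ (a := ∑ i, c i * l i)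
    (b := (∑ i, c i * (ν i).natAbs) + b) (n₀ := N) fun n hn => ?_
  have h0 : n₀ ≤ n := le_trans (Nat.le_add_right _ _) hn
  calc classNumberPExp κ n ≤ (∑ i, c i * classNumberPExp (κs i) n) + b := hle n h0
    _ ≤ (∑ i, c i * (l i * n + (ν i).natAbs)) + b := by
        gcongr with i
        exact hbd i n hn
    _ = (∑ i, c i * l i) * n + ((∑ i, c i * (ν i).natAbs) + b) := by
        rw [Finset.sum_mul, ← add_assoc, ← Finset.sum_add_distrib]
        refine congrArg (· + b) (Finset.sum_congr rfl fun i _ => by ring)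

/-- **μ-descent, Kuroda form (fact-free).**  Four `ℤ_p`-extensions `κ_L, κ_X, κ_K, κ_k` (of number fields
`L, X, K, k`) whose exponents satisfy KURODA'S RELATION `e_n(κ_L) + 2 e_n(κ_k) = e_n(κ_X) + 2 e_n(κ_K)` for all
`n ≥ n₀` — [Lemmermeyer1994] §1, odd part, for a biquadratic layer `L_n/k_n` with intermediate fields
`X_n, K_n, K_n'` and `h(K_n') = h(K_n)` (dihedral / semidihedral `Gal(L_n/F)`; tree theorem
`KurodaOddPart.card_torsion_classGroup_dihedral` at `q = p^m` large, layer by layer, with the sub-towers identified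
with the fixed fields of the layers): if `κ_X`, `κ_K`, `κ_k` have `μ = 0` in growth form, so does `κ_L`, with
`e_n(κ_L) = (λ_X + 2λ_K − 2λ_k) n + (ν_X + 2ν_K − 2ν_k)` for `n ≫ 0`.  No growth theorem is needed.
[cite: Lemmermeyer1994, §1 (Kuroda's formula, odd part)] [cite: RaySujatha2021, §1 eq. (1.1)] -/
theorem classicalMuVanishes_of_kuroda {L X E k : Type} [Field L] [NumberField L] [Field X] [NumberField X]
    [Field E] [NumberField E] [Field k] [NumberField k] (κL : ZpExtension L p) (κX : ZpExtension X p)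
    (κE : ZpExtension E p) (κk : ZpExtension k p) {n₀ : ℕ}
    (hrel : ∀ n, n₀ ≤ n →
      classNumberPExp κL n + 2 * classNumberPExp κk n = classNumberPExp κX n + 2 * classNumberPExp κE n)
    (hX : ClassicalMuVanishes κX) (hE : ClassicalMuVanishes κE) (hk : ClassicalMuVanishes κk) :
    ClassicalMuVanishes κL := by
  obtain ⟨lX, νX, nX, hX⟩ := hX
  obtain ⟨lE, νE, nE, hE⟩ := hE
  obtain ⟨lk, νk, nk, hk⟩ := hk
  refine classicalMuVanishes_of_eventually_intLinear κL (l := lX + 2 * lE - 2 * lk)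
    (ν := νX + 2 * νE - 2 * νk) (n₀ := n₀ + nX + nE + nk) fun n hn => ?_
  have h1 := hrel n (by omega)
  have h2 := hX n (by omega)
  have h3 := hE n (by omega)
  have h4 := hk n (by omega)
  have h1' : (classNumberPExp κL n : ℤ) + 2 * classNumberPExp κk n =
      classNumberPExp κX n + 2 * classNumberPExp κE n := by exact_mod_cast h1
  linear_combination h1' + h2 + 2 * h3 - 2 * h4

end Literature.NumberTheory.IwasawaTheory
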